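import Mathlib
import HarnessLib
import Literature.ComputerArithmetic.Lefevre2005.SegmentGrid
import Literature.ComputerArithmetic.BrisebarreHanrotMullerZimmermann2025.TableMakersDilemma

/-!
# A sub-domain certificate: Lefèvre's segment test ⟹ no bad case of the Table Maker's Dilemma

[Lefevre2005, §2.1]: "in each sub-domain, one chooses an approximating polynomial of degree 1: P(x) − ax ≡ b
[the true values lying within a known error of the segment] … find all integers k, 0 ≤ k < N, such that
{b − k·a} < d₀ for some real d₀ (one generally chooses a bound slightly larger than [the target] to take
into account the error)"; the search then "eliminates" every sub-domain on which Algorithm 1 finds no such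
k. This file packages exactly that elimination step in the vocabulary of the TMD
([BrisebarreEtAl2025, Problems 4.1/4.2], `Literature.ComputerArithmetic.BrisebarreHanrotMullerZimmermann2025`):
if on the piece `X₀, X₀+1, …, X₀+N−1` of the significand range the scaled function
`g(X) = 2^(p−1−e₂)·f(X·2^(e₁−p+1))` is within `δ` of the segment `b − k·a` (`k = X − X₀`), and the
shifted/doubled test `N ≤ algorithm1 a (b + w) (2w) N` holds with `2^(−μ) + δ ≤ w`, then NO point of the
piece is a `μ`-bad case for the directed roundings; with `b − 1/2` in place of `b`, none is a `μ`-bad case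
for rounding to nearest. For rational `a, b, w` the test is decided over `ℚ` by kernel evaluation
(`Lefevre2005.le_algorithm1_ratCast_iff`), the approximation hypothesis being the only analytic input.
All statements PROVED (they are corollaries of `Lefevre2005.le_abs_sub_int_of_algorithm1`); no named facts.

(Appended) **The approximation hypothesis from a second-derivative bound** — [Lefevre2005, §2.1]: "one
chooses an approximating polynomial of degree 1 … one generally chooses a bound slightly larger … to take
into account the error": `abs_sub_taylor_one_le` (`|g x − g x₀ − (x−x₀)·g′ x₀| ≤ M(x−x₀)²/2` from
`|g″| ≤ M`, sharp constant, via Mathlib's `image_le_of_deriv_right_le_deriv_boundary`),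
`approx_of_second_deriv_bound` (the piece hypothesis `|g(X₀+k) − (b − k·a)| ≤ δ` for ANY segment data
`a, b` within `η₁, η₀` of `−g′(X₀), g(X₀)`, once `η₀ + N·η₁ + M·N²/2 ≤ δ`), `hasDerivAt_scaled`
(derivatives of the scaled function) and `approx_scaled_of_second_deriv_bound` (the same for
`scaled f p e₁ e₂` from `|f″| ≤ M_f` on the piece: `δ ≥ η₀ + N·η₁ + 2^(2e₁−e₂−p+1)·M_f·N²/2`). With these,
a piece certificate is: an elementary bound on `f″` + two rational closeness checks + the kernel-decided test.
-/

namespace Literature.ComputerArithmetic.Lefevre2005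

open Literature.ComputerArithmetic.BrisebarreHanrotMullerZimmermann2025

section

variable {f : ℝ → ℝ} {p : ℕ} {e₁ e₂ X₀ : ℤ} {N μ : ℕ}

/-- **Sub-domain elimination, directed roundings.** If the scaled values on the piece `X₀ + k`, `k < N`, are
within `δ` of the segment `b − k·a`, `2^(−μ) + δ ≤ w`, and Lefèvre's test finds no `k < N` with
`{b + w − k·a} < 2w`, then no point of the piece is a `μ`-bad case for the directed roundings.
[cite: Lefevre2005, §2.1 and Algorithm 1; BrisebarreEtAl2025, Problem 4.1] -/
theorem not_isBadCaseDir_of_algorithm1 {a b δ w : ℝ}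
    (happrox : ∀ k : ℕ, k < N → |scaled f p e₁ e₂ (X₀ + k) - (b - k * a)| ≤ δ)
    (hw : (2 : ℝ) ^ (-(μ : ℤ)) + δ ≤ w) (halg : N ≤ algorithm1 a (b + w) (2 * w) N) :
    ∀ k : ℕ, k < N → ¬ IsBadCaseDir μ (scaled f p e₁ e₂ (X₀ + k)) := by
  intro k hk
  rw [not_isBadCaseDir_iff]
  intro m
  exact le_abs_sub_int_of_algorithm1 (g := fun k : ℕ => scaled f p e₁ e₂ (X₀ + k)) happrox hw halg k hk m

/-- **Sub-domain elimination, rounding to nearest**: the same test run on the segment shifted by `−1/2`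
(midpoints `m + 1/2` become integers) excludes `μ`-bad cases for rounding to nearest.
[cite: Lefevre2005, §2.1 and Algorithm 1; BrisebarreEtAl2025, Problem 4.2] -/
theorem not_isBadCaseRN_of_algorithm1 {a b δ w : ℝ}
    (happrox : ∀ k : ℕ, k < N → |scaled f p e₁ e₂ (X₀ + k) - (b - k * a)| ≤ δ)
    (hw : (2 : ℝ) ^ (-(μ : ℤ)) + δ ≤ w) (halg : N ≤ algorithm1 a (b - 1 / 2 + w) (2 * w) N) :
    ∀ k : ℕ, k < N → ¬ IsBadCaseRN μ (scaled f p e₁ e₂ (X₀ + k)) := by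
  intro k hk
  rw [not_isBadCaseRN_iff]
  intro m
  have happrox' : ∀ k : ℕ, k < N →
      |(scaled f p e₁ e₂ (X₀ + k) - 1 / 2) - ((b - 1 / 2) - k * a)| ≤ δ := fun k hk => by
    rw [show (scaled f p e₁ e₂ (X₀ + k) - 1 / 2) - ((b - 1 / 2) - k * a) =
      scaled f p e₁ e₂ (X₀ + k) - (b - k * a) by ring]
    exact happrox k hk
  have h := le_abs_sub_int_of_algorithm1 (g := fun k : ℕ => scaled f p e₁ e₂ (X₀ + k) - 1 / 2)
    happrox' hw halg k hk m
  rwa [show scaled f p e₁ e₂ (X₀ + k) - 1 / 2 - (m : ℝ) = scaled f p e₁ e₂ (X₀ + k) - (m + 1 / 2) by ring]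
    at h

/-- Directed roundings, with the test DECIDED OVER `ℚ`: for rational segment data `a, b` and half-width `w`
the hypothesis `N ≤ algorithm1 a (b + w) (2 * w) N` is a closed rational computation (`decide +kernel`),
and it transports to `ℝ` by `le_algorithm1_ratCast_iff`. [cite: Lefevre2005, §2.1 and Algorithm 1;
BrisebarreEtAl2025, Problem 4.1] -/
theorem not_isBadCaseDir_of_algorithm1_rat {a b w : ℚ} {δ : ℝ}
    (happrox : ∀ k : ℕ, k < N → |scaled f p e₁ e₂ (X₀ + k) - ((b : ℝ) - k * (a : ℝ))| ≤ δ)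
    (hw : (2 : ℝ) ^ (-(μ : ℤ)) + δ ≤ (w : ℝ)) (halg : N ≤ algorithm1 a (b + w) (2 * w) N) :
    ∀ k : ℕ, k < N → ¬ IsBadCaseDir μ (scaled f p e₁ e₂ (X₀ + k)) := by
  have halg' : N ≤ algorithm1 ((a : ℚ) : ℝ) (((b + w : ℚ)) : ℝ) (((2 * w : ℚ)) : ℝ) N :=
    (le_algorithm1_ratCast_iff (K := ℝ) a (b + w) (2 * w) N).2 halg
  push_cast at halg'
  exact not_isBadCaseDir_of_algorithm1 happrox hw halg'

/-- Rounding to nearest, with the test decided over `ℚ` (segment shifted by `−1/2`).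
[cite: Lefevre2005, §2.1 and Algorithm 1; BrisebarreEtAl2025, Problem 4.2] -/
theorem not_isBadCaseRN_of_algorithm1_rat {a b w : ℚ} {δ : ℝ}
    (happrox : ∀ k : ℕ, k < N → |scaled f p e₁ e₂ (X₀ + k) - ((b : ℝ) - k * (a : ℝ))| ≤ δ)
    (hw : (2 : ℝ) ^ (-(μ : ℤ)) + δ ≤ (w : ℝ)) (halg : N ≤ algorithm1 a (b - 1 / 2 + w) (2 * w) N) :
    ∀ k : ℕ, k < N → ¬ IsBadCaseRN μ (scaled f p e₁ e₂ (X₀ + k)) := by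
  have halg' : N ≤ algorithm1 ((a : ℚ) : ℝ) (((b - 1 / 2 + w : ℚ)) : ℝ) (((2 * w : ℚ)) : ℝ) N :=
    (le_algorithm1_ratCast_iff (K := ℝ) a (b - 1 / 2 + w) (2 * w) N).2 halg
  push_cast at halg'
  exact not_isBadCaseRN_of_algorithm1 happrox hw halg'

/-- How the pieces assemble into the binade statement of Problem 4.1: if every significand of
`⟦2^(p−1), 2^p − 1⟧` is no `μ`-bad case (directed), then the hardness to round on the binade is `≤ μ`
(the exactness hypothesis and the range of `Y` in `HardnessToRoundDirLE` are not even needed).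
[cite: BrisebarreEtAl2025, Problem 4.1 and §4.4] -/
theorem hardnessToRoundDirLE_of_forall_not_isBadCaseDir
    (h : ∀ X ∈ sigRange p, ¬ IsBadCaseDir μ (scaled f p e₁ e₂ X)) :
    HardnessToRoundDirLE f p e₁ e₂ μ := by
  intro X hX _ Y _
  exact (not_isBadCaseDir_iff μ _).1 (h X hX) Y

/-- Rounding-to-nearest analogue: no `μ`-bad case on the binade ⟹ `HardnessToRoundRNLE … μ`.
[cite: BrisebarreEtAl2025, Problem 4.2 and §4.4] -/
theorem hardnessToRoundRNLE_of_forall_not_isBadCaseRN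
    (h : ∀ X ∈ sigRange p, ¬ IsBadCaseRN μ (scaled f p e₁ e₂ X)) :
    HardnessToRoundRNLE f p e₁ e₂ μ := by
  intro X hX _ Y _
  exact (not_isBadCaseRN_iff μ _).1 (h X hX) Y

end

/-! ### A toy end-to-end instance (the linear function `f x = x/3` on `[1,2)`, `p = 12`)

For `f x = x/3`, `e₁ = 0`, `e₂ = −2` (`x/3 ∈ [1/3, 2/3) ⊂ [1/4, 1/2)·2 …` — only the algebra matters here),
the scaled function is `g(X) = 2^13 · (X·2^(−11))/3 = 4X/3`, which IS a segment (`δ = 0`, slope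
`a = −4/3` in Lefèvre's sign convention `b − k·a`). Its distance to the integers is `0` (when `3 ∣ X`) or
`1/3`; on the 2-point piece `X₀ = 2^11 + 2`, `N = 2` (no multiple of 3) the test with `w = 1/4` certifies
that neither point is a `2`-bad case (`1/3 ≥ 2^(−2)`), the `algorithm1` hypothesis being discharged by
`decide +kernel` over `ℚ`.
-/

example : ∀ k : ℕ, k < 2 →
    ¬ IsBadCaseDir 2 (scaled (fun x : ℝ => x / 3) 12 0 (-2) ((2 ^ 11 + 2 : ℤ) + k)) := by
  refine not_isBadCaseDir_of_algorithm1_rat (a := -4 / 3) (b := 4 * (2 ^ 11 + 2) / 3) (w := 1 / 4)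
    (δ := 0) (fun k hk => ?_) (by norm_num) (by decide +kernel)
  interval_cases k <;> · rw [scaled_def]; norm_num

/-! ### (Appended) The approximation hypothesis from a second-derivative bound -/

section Approximation

open Set

/-- **Degree-1 Taylor bound with the sharp constant.** If `g` has derivative `g′` and `g′` has derivative
`g″` on `[x₀, x₁]` with `|g″| ≤ M` there, then `|g x − (g x₀ + (x − x₀)·g′ x₀)| ≤ M·(x − x₀)²/2` on
`[x₀, x₁]` (mean value inequality for `g′`, then the ODE comparison lemma
`image_le_of_deriv_right_le_deriv_boundary` against `B(x) = M(x−x₀)²/2`). This is the error of "the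
approximating polynomial of degree 1" of a sub-domain. [cite: Lefevre2005, §2.1] -/
theorem abs_sub_taylor_one_le {g g' g'' : ℝ → ℝ} {x₀ x₁ M : ℝ}
    (hg : ∀ x ∈ Icc x₀ x₁, HasDerivAt g (g' x) x) (hg' : ∀ x ∈ Icc x₀ x₁, HasDerivAt g' (g'' x) x)
    (hM : ∀ x ∈ Icc x₀ x₁, |g'' x| ≤ M) {x : ℝ} (hx : x ∈ Icc x₀ x₁) :
    |g x - (g x₀ + (x - x₀) * g' x₀)| ≤ M * (x - x₀) ^ 2 / 2 := by
  have h01 : x₀ ≤ x₁ := hx.1.trans hx.2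
  have hx₀ : x₀ ∈ Icc x₀ x₁ := left_mem_Icc.2 h01
  -- increment of g' (mean value inequality)
  have hψ : ∀ y ∈ Icc x₀ x₁, |g' y - g' x₀| ≤ M * (y - x₀) := by
    intro y hy
    have h := (convex_Icc x₀ x₁).norm_image_sub_le_of_norm_hasDerivWithin_le
      (fun z hz => (hg' z hz).hasDerivWithinAt) (fun z hz => by rw [Real.norm_eq_abs]; exact hM z hz) hx₀ hy
    rwa [Real.norm_eq_abs, Real.norm_eq_abs, abs_of_nonneg (sub_nonneg.2 hy.1)] at h
  -- the defect and the comparison function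
  have hφ : ∀ y ∈ Icc x₀ x₁,
      HasDerivAt (fun y => g y - (g x₀ + (y - x₀) * g' x₀)) (g' y - g' x₀) y := by
    intro y hy
    refine ((hg y hy).sub ((((hasDerivAt_id y).sub_const x₀).mul_const (g' x₀)).const_add (g x₀))).congr_deriv ?_
    ring
  have hB : ∀ y, HasDerivAt (fun y => M * (y - x₀) ^ 2 / 2) (M * (y - x₀)) y := by
    intro y
    refine (((((hasDerivAt_id y).sub_const x₀).pow 2).const_mul M).div_const 2).congr_deriv ?_
    push_cast; simp only [id_eq]; ring
  have hBc : ContinuousOn (fun y => M * (y - x₀) ^ 2 / 2) (Icc x₀ x₁) :=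
    fun y _ => (hB y).continuousAt.continuousWithinAt
  have upper : ∀ y ∈ Icc x₀ x₁, g y - (g x₀ + (y - x₀) * g' x₀) ≤ M * (y - x₀) ^ 2 / 2 := by
    intro y hy
    refine image_le_of_deriv_right_le_deriv_boundary (f := fun y => g y - (g x₀ + (y - x₀) * g' x₀))
      (fun z hz => (hφ z hz).continuousAt.continuousWithinAt)
      (fun z hz => (hφ z ⟨hz.1, hz.2.le⟩).hasDerivWithinAt) (by simp) hBc
      (fun z _ => (hB z).hasDerivWithinAt) (fun z hz => ?_) hy
    exact (le_abs_self _).trans (hψ z ⟨hz.1, hz.2.le⟩)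
  have lower : ∀ y ∈ Icc x₀ x₁, -(g y - (g x₀ + (y - x₀) * g' x₀)) ≤ M * (y - x₀) ^ 2 / 2 := by
    intro y hy
    refine image_le_of_deriv_right_le_deriv_boundary (f := fun y => -(g y - (g x₀ + (y - x₀) * g' x₀)))
      (fun z hz => (hφ z hz).neg.continuousAt.continuousWithinAt)
      (fun z hz => (hφ z ⟨hz.1, hz.2.le⟩).neg.hasDerivWithinAt) (by simp) hBc
      (fun z _ => (hB z).hasDerivWithinAt) (fun z hz => ?_) hy
    exact (neg_le_abs _).trans (hψ z ⟨hz.1, hz.2.le⟩)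
  exact abs_le.2 ⟨by linarith [lower x hx], upper x hx⟩

/-- **The piece hypothesis from a second-derivative bound.** If `|g″| ≤ M` on `[X₀, X₀ + N]` and the
segment data are `η₀`-close to `g(X₀)` and `η₁`-close to `−g′(X₀)` (Lefèvre's sign convention `b − k·a`;
`a, b` are typically roundings of the Taylor coefficients), then every point of the piece is within
`δ ≥ η₀ + N·η₁ + M·N²/2` of the segment — the hypothesis `happrox` of `not_isBadCaseDir_of_algorithm1` /
`not_isBadCaseRN_of_algorithm1`. [cite: Lefevre2005, §2.1] -/
theorem approx_of_second_deriv_bound {g g' g'' : ℝ → ℝ} {X₀ : ℤ} {N : ℕ} {a b M η₀ η₁ δ : ℝ}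
    (hg : ∀ x ∈ Icc (X₀ : ℝ) (X₀ + N), HasDerivAt g (g' x) x)
    (hg' : ∀ x ∈ Icc (X₀ : ℝ) (X₀ + N), HasDerivAt g' (g'' x) x)
    (hM : ∀ x ∈ Icc (X₀ : ℝ) (X₀ + N), |g'' x| ≤ M)
    (hb : |g X₀ - b| ≤ η₀) (ha : |g' X₀ + a| ≤ η₁) (hδ : η₀ + N * η₁ + M * (N : ℝ) ^ 2 / 2 ≤ δ) :
    ∀ k : ℕ, k < N → |g ((X₀ : ℝ) + k) - (b - k * a)| ≤ δ := by
  intro k hk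
  have hkN : (k : ℝ) ≤ N := by exact_mod_cast hk.le
  have hk0 : (0 : ℝ) ≤ k := by positivity
  have hx : ((X₀ : ℝ) + k) ∈ Icc (X₀ : ℝ) (X₀ + N) := ⟨by linarith, by linarith⟩
  have hT := abs_sub_taylor_one_le hg hg' hM hx
  rw [show (X₀ : ℝ) + k - X₀ = k by ring] at hT
  have hM0 : 0 ≤ M := (abs_nonneg _).trans (hM _ hx)
  have hη₁ : 0 ≤ η₁ := (abs_nonneg _).trans ha
  have hk2 : M * (k : ℝ) ^ 2 / 2 ≤ M * (N : ℝ) ^ 2 / 2 := by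
    have : (k : ℝ) ^ 2 ≤ (N : ℝ) ^ 2 := pow_le_pow_left₀ hk0 hkN 2
    nlinarith
  have hsplit : g ((X₀ : ℝ) + k) - (b - k * a)
      = (g ((X₀ : ℝ) + k) - (g X₀ + k * g' X₀)) + (g X₀ - b) + k * (g' X₀ + a) := by ring
  rw [hsplit]
  calc |(g ((X₀ : ℝ) + k) - (g X₀ + k * g' X₀)) + (g X₀ - b) + k * (g' X₀ + a)|
      ≤ |g ((X₀ : ℝ) + k) - (g X₀ + k * g' X₀)| + |g X₀ - b| + |k * (g' X₀ + a)| := abs_add_three _ _ _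
    _ ≤ M * (N : ℝ) ^ 2 / 2 + η₀ + N * η₁ := by
        rw [abs_mul, abs_of_nonneg hk0]
        have : (k : ℝ) * |g' ↑X₀ + a| ≤ N * η₁ := mul_le_mul hkN ha (abs_nonneg _) (by positivity)
        linarith
    _ ≤ δ := by linarith

/-- Derivative of the scaled function `x ↦ 2^(p−1−e₂)·f(x·2^(e₁−p+1))` of Problem 4.1, as a function of a
REAL significand variable: `2^(p−1−e₂)·2^(e₁−p+1)·f′ = 2^(e₁−e₂)·f′`; stated for an arbitrary constant
`C` so that it applies to `f′` as well. [cite: BrisebarreEtAl2025, Problem 4.1] -/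
theorem hasDerivAt_const_mul_comp_scale {f f' : ℝ → ℝ} {C s x : ℝ}
    (hf : HasDerivAt f (f' (x * s)) (x * s)) :
    HasDerivAt (fun y : ℝ => C * f (y * s)) (C * s * f' (x * s)) x := by
  have h := (hf.comp x ((hasDerivAt_id x).mul_const s)).const_mul C
  refine h.congr_deriv ?_
  ring

/-- **The piece hypothesis for `scaled f p e₁ e₂` from a bound on `f″`.** On the piece of significands
`X₀, …, X₀+N−1` (arguments `x = X·2^(e₁−p+1)`), if `|f″| ≤ M_f` on the corresponding real interval and the
segment data `b, a` are within `η₀, η₁` of `scaled f p e₁ e₂ X₀` and of `−2^(e₁−e₂)·f′(X₀·2^(e₁−p+1))`, then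
`|scaled f p e₁ e₂ (X₀+k) − (b − k·a)| ≤ δ` for all `k < N` as soon as
`η₀ + N·η₁ + 2^(2e₁−e₂−p+1)·M_f·N²/2 ≤ δ`. [cite: Lefevre2005, §2.1; BrisebarreEtAl2025, Problem 4.1] -/
theorem approx_scaled_of_second_deriv_bound {f f' f'' : ℝ → ℝ} {p : ℕ} {e₁ e₂ X₀ : ℤ} {N : ℕ}
    {a b Mf η₀ η₁ δ : ℝ}
    (hf : ∀ y ∈ Icc ((X₀ : ℝ) * (2 : ℝ) ^ (e₁ - p + 1)) (((X₀ : ℝ) + N) * (2 : ℝ) ^ (e₁ - p + 1)),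
      HasDerivAt f (f' y) y)
    (hf' : ∀ y ∈ Icc ((X₀ : ℝ) * (2 : ℝ) ^ (e₁ - p + 1)) (((X₀ : ℝ) + N) * (2 : ℝ) ^ (e₁ - p + 1)),
      HasDerivAt f' (f'' y) y)
    (hMf : ∀ y ∈ Icc ((X₀ : ℝ) * (2 : ℝ) ^ (e₁ - p + 1)) (((X₀ : ℝ) + N) * (2 : ℝ) ^ (e₁ - p + 1)),
      |f'' y| ≤ Mf)
    (hb : |scaled f p e₁ e₂ X₀ - b| ≤ η₀)
    (ha : |(2 : ℝ) ^ (e₁ - e₂) * f' ((X₀ : ℝ) * (2 : ℝ) ^ (e₁ - p + 1)) + a| ≤ η₁)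
    (hδ : η₀ + N * η₁ + (2 : ℝ) ^ (2 * e₁ - e₂ - p + 1) * Mf * (N : ℝ) ^ 2 / 2 ≤ δ) :
    ∀ k : ℕ, k < N → |scaled f p e₁ e₂ (X₀ + k) - (b - k * a)| ≤ δ := by
  set s : ℝ := (2 : ℝ) ^ (e₁ - p + 1) with hs
  have hs0 : 0 < s := by positivity
  set C : ℝ := (2 : ℝ) ^ ((p : ℤ) - 1 - e₂) with hC
  have hCs : C * s = (2 : ℝ) ^ (e₁ - e₂) := by
    rw [hC, hs, ← zpow_add₀ (by norm_num : (2 : ℝ) ≠ 0)]; congr 1; ring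
  have hCss : C * s * s = (2 : ℝ) ^ (2 * e₁ - e₂ - p + 1) := by
    rw [hCs, hs, ← zpow_add₀ (by norm_num : (2 : ℝ) ≠ 0)]; congr 1; ring
  -- the scaled function of a real variable and its two derivatives
  let g : ℝ → ℝ := fun y => C * f (y * s)
  let g' : ℝ → ℝ := fun y => C * s * f' (y * s)
  let g'' : ℝ → ℝ := fun y => C * s * s * f'' (y * s)
  have hmem : ∀ y ∈ Icc (X₀ : ℝ) (X₀ + N), y * s ∈ Icc ((X₀ : ℝ) * s) (((X₀ : ℝ) + N) * s) :=
    fun y hy => ⟨mul_le_mul_of_nonneg_right hy.1 hs0.le, mul_le_mul_of_nonneg_right hy.2 hs0.le⟩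
  have hg : ∀ y ∈ Icc (X₀ : ℝ) (X₀ + N), HasDerivAt g (g' y) y :=
    fun y hy => hasDerivAt_const_mul_comp_scale (hf _ (hmem y hy))
  have hg' : ∀ y ∈ Icc (X₀ : ℝ) (X₀ + N), HasDerivAt g' (g'' y) y :=
    fun y hy => hasDerivAt_const_mul_comp_scale (hf' _ (hmem y hy))
  have hM : ∀ y ∈ Icc (X₀ : ℝ) (X₀ + N), |g'' y| ≤ C * s * s * Mf := by
    intro y hy
    show |C * s * s * f'' (y * s)| ≤ C * s * s * Mf
    have hCss0 : 0 ≤ C * s * s := by positivity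
    rw [abs_mul, abs_of_nonneg hCss0]
    exact mul_le_mul_of_nonneg_left (hMf _ (hmem y hy)) hCss0
  have hgX : g X₀ = scaled f p e₁ e₂ X₀ := by simp [g, scaled_def, hC, hs]
  have hb' : |g X₀ - b| ≤ η₀ := by rw [hgX]; exact hb
  have ha' : |g' X₀ + a| ≤ η₁ := by
    show |C * s * f' ((X₀ : ℝ) * s) + a| ≤ η₁
    rw [hCs]; exact ha
  have hδ' : η₀ + N * η₁ + C * s * s * Mf * (N : ℝ) ^ 2 / 2 ≤ δ := by rw [hCss]; exact hδ
  intro k hk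
  have h := approx_of_second_deriv_bound hg hg' hM hb' ha' hδ' k hk
  have hgk : g ((X₀ : ℝ) + k) = scaled f p e₁ e₂ (X₀ + k) := by
    simp [g, scaled_def, hC, hs]
  rwa [hgk] at h

end Approximation

/-! ### A toy NONLINEAR instance: `f x = x²`, piece `X₀ = 2073`, `N = 4` (`p = 12`, `e₁ = e₂ = 0`)

Here the approximation hypothesis comes from `approx_scaled_of_second_deriv_bound` (`f′ = 2x`, `f″ = 2`,
exact Taylor data `b = 2073²/2^11`, `a = −2073/2^10`, so `η₀ = η₁ = 0` and `δ = 2^(−11)·2·4²/2 = 1/128`),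
NOT from evaluating `f` at the four points; the test with `w = 1/4 + 1/128 = 33/128` is decided over `ℚ`.
So no point of the piece is a `2`-bad case of `x ↦ x²` for the directed roundings (indeed `X²/2^11 mod 1`
is `0.305…, 0.330…, 0.356…, 0.383…` there). [cite: Lefevre2005, §2.1]
-/

example : ∀ k : ℕ, k < 4 → ¬ IsBadCaseDir 2 (scaled (fun x : ℝ => x ^ 2) 12 0 0 ((2073 : ℤ) + k)) := by
  have happrox := approx_scaled_of_second_deriv_bound (f := fun x : ℝ => x ^ 2) (f' := fun x : ℝ => 2 * x)
    (f'' := fun _ : ℝ => (2 : ℝ)) (p := 12) (e₁ := 0) (e₂ := 0) (X₀ := 2073) (N := 4)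
    (a := ((-2073 / 1024 : ℚ) : ℝ)) (b := ((2073 ^ 2 / 2048 : ℚ) : ℝ)) (Mf := 2) (η₀ := 0) (η₁ := 0)
    (δ := 1 / 128)
    (fun y _ => by simpa using hasDerivAt_pow 2 y)
    (fun y _ => by simpa using (hasDerivAt_id' y).const_mul (2 : ℝ))
    (fun y _ => by norm_num) (by rw [scaled_def]; push_cast; norm_num) (by push_cast; norm_num) (by norm_num)
  exact not_isBadCaseDir_of_algorithm1_rat (w := 33 / 128) happrox (by norm_num) (by decide +kernel)

end Literature.ComputerArithmetic.Lefevre2005
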